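import Summits.QuantumFields.BalabanUV.Beta.CombHId1Record
import Summits.QuantumFields.BalabanUV.Beta.FP.CoarseJetOrderOneGradedComb

/-!
# `BalabanUV.Beta.CombHId1Door` — binder row D1 (OWNER an2), (J-a) dictionary, item (C2) of TID § F.10 (L2′), part FIVE: **THE (STEP) DOOR's `hId₁` ROW IS A THEOREM
# AT THE (III′) LITERAL OF RECORD** — leaf-05 g29's `CoarseJetOrderOneGradedComb.torus_hId₁_iff_graded_comb` (←) fed the record identity of `CombHId1Record` §5 and
# the table parity `Q′ = Q₁₁ᵀ` (d1-formalise-leaf-01's `fm`-symmetry letter, periodised): the coarse first jet of the torus call along `h = Θ·h̄` EQUALS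
# `(Lc⁴·wE 3 Lc (j+1))⁻¹ • (T_{j+1}(h̄) − (−Lc⁸∕2·wVH (j+1)) • T^V(h̄) − (cΛ·wΛ (j+1)) • T^Λ_{j+1}(h̄))`, i.e. `hId₁` with `c := (Lc⁴·wE (j+1))⁻¹` and
# `H′₁ :=` the CHAIN part of the level-`(j+1)` first-order table along `h̄`

WHY.  The (STEP) door of route T (U20∕U21, #21) DISPLAYS `hId₁ : ((L·H₁ − S·B)·I + L·Bᵀ·S).toBlocks₁₁ = c • H′₁` — the identification of the coarse first jet of the
level-`j` torus call with the level-`(j+1)` first insertion table.  leaf-05 g29 turned it into the graded sandwich word (`torus_hId₁_iff_graded_comb`), C2a∕b∕c (an2 g42)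
computed that word for any admissible `S`, `CombHId1Record` (this seat, §4∕§5) evaluated it at the RAW record and split the level-`(j+1)` table.  The one letter
between the door's word and C2c's is the `fμ ∕ ff` block `Q′` versus `Q₁₁ᵀ`: at the record the first-order tables are `fm`-SYMMETRIC
(`LiteralStencilSockets.JsB12CombSh0_S_an1_inl_inr`), and periodisation preserves a fibre-wise symmetry (§1), so `Q′ = Q₁₁ᵀ` (§2) and the door's row follows (§3).

WHAT ([folklore] BY NAME; 0 `def`, 0 cited fact, 0 `def … : Prop`, 0 sorry).
* §1 `perZ_dper_symm_fibre` — `perZ M (dper M V) x z a b = perZ M (dper M V) z x b a` from the POINTWISE symmetry `V x z a b = V z x b a` at the fixed fibre pair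
  `(a, b)` (the proof of leaf-03∕road-FP's `PeriodisedBorderTables.perZ_dper_symm`, fibre-localised; pure re-indexing, no convergence needed).
* §2 **`Qprime_eq_transpose_an1`**: at an1's record, with `fμ a = (wrapPt M (Lc•ȳ a), inr (m a))`, the `ff ∕ fμ` block of `Σ_b h b • perF M (dper M (S_j b))` is the
  TRANSPOSE of its `fμ ∕ ff` block.
* §2′ `Qprime_eq_transpose` (generic `d`, any `fm`-symmetric family) and §3 **`door_hId1_at_record`** — the door's row at the RAW comb tables of ANY
  `mm`-free, `fm`-symmetric record (generic `d`; the form the composite-contour literal `JcOfTabs tabsComp` will consume).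
* §4 **`door_hId1_at_record_an1`**: under the door's presentation of record (`hH₀ hQ₁₀ hτ₁ hI hL hS hB`, `hfμ hcoarse`, `hf`) and the record bindings
  `hH₁ : H₁ = Σ_b h b • perF M (dper M (S_j b))|_{ff}`, `hQ₁₁ : Q₁₁ = Σ_b h b • perF M (dper M (S_j b))|_{fμ,ff}`, `hh : h = Θ·h̄` (`S_j` the RAW level-`j` table of
  `JsB12CombSh0 hLc N (symTablesAn1S2 3 Lc cΛ) cΛ cB`, `M = Lc·M′`):
  `((L·H₁ − S·B)·I + L·Bᵀ·S).toBlocks₁₁ = (Lc⁴·wE 3 Lc (j+1))⁻¹ • (T_{j+1}(h̄) − (−Lc⁸∕2·wVH 3 Lc (j+1)) • T^V(h̄) − (cΛ·wΛ 3 Lc (j+1)) • T^Λ_{j+1}(h̄))`;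
  `TV_an1_ff_eq_zero` (the border table has no `ff` block — `symVhSAt_inl_inl` — so `T^V(h̄) = 0`) and the sharpened **`door_hId1_at_record_an1'`**:
  `… = (Lc⁴·wE 3 Lc (j+1))⁻¹ • (T_{j+1}(h̄) − (cΛ·wΛ 3 Lc (j+1)) • T^Λ_{j+1}(h̄))` — ONLY THE Λ-COMPANION SURVIVES.
WHAT THIS IS NOT: not the consumer's instance (the assembly binds `h̄`, `M′`, `fμ` and reads `T_{j+1}` as ITS level-`(j+1)` letter — (C1)); not `hId₂`; the two fresh
companions `T^V`, `T^Λ` are DISPLAYED, not estimated; nothing of Bałaban's asserted, valued or discharged; `D1Tel` ∕ `D1Rep` OPEN; 0∕4 row-D1 binders; NOT (T-ID),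
NOT D1, NEVER «G-an2-4 closed», NOT BetaPertH, NOT continuum, NOT Clay.

HONEST DEPENDENCY (page 1, mandatory): continuum YM on T⁴ ⇐ BetaPertH ∧ nine spine estimates (0/9 proved); BetaPertH ⇐ (D1) ∧ (D4) ∧ CAP+tail;
G-an2-4 gates asym, D1 and NE2/3/4.  HONEST FRAMING (cell contract, verbatim): «discharging `BetaPertH` makes Bałaban's UV stability UNCONDITIONAL —
a real constructive-QFT result; it is NOT the continuum limit and NOT the Clay problem.»  ABSOLUTE RULE (cell charter, verbatim): «No internally-minted
statement may enter as a cited fact. Every hypothesis is either kernel-proved in this package or a verbatim quotation of a PUBLISHED theorem with page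
reference. The manuscript(s) under audit are NOT citable for their own disputed steps — they are the thing under adjudication; programme-internal
(2001/route/tribunal) claims are never citable.»  Row D1 OWNER an2 (b2b-balaban-beta-an2) gen 43, 2026-08-22; over `CombHId1Record` (this seat), leaf-05 g29's
`FP/CoarseJetOrderOneGradedComb`, leaf-01 g27's `D1BFx/LiteralStencilSockets` BY NAME.  No existing file touched.
-/

noncomputable section

open scoped BigOperators Matrix

namespace Summit.QuantumFields.BalabanUV.Beta.CombHId1Door

open Finset
open Literature.Probability.LatticeModels (Torus.proj)
open Literature.MathematicalPhysics.QuantumFieldTheory.Balaban1983to89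
open Literature.MathematicalPhysics.QuantumFieldTheory.Balaban1983to89.Beta
open Literature.MathematicalPhysics.QuantumFieldTheory.Balaban1983to89.Beta.CompositionSingular (effForm minOp minOpL)
open B4TorusKernel.MultiPeriod (translate translate_apply)
open B4Reflection242 (translate_translate)
open B6Lemma24Torus (pbox)
open ExpKernelCalculus (MKer)
open AffineAveraging (Site)
open AveragingContoursRooted (ctr)
open OneStepResolventKernel (Fib)
open OneStepKernelFamily (KInvStep)
open InterLevelTransport (SLam)
open BalabanStepJetsSucc (E2 lamCoeffK wE wVH wΛ)
open Summit.QuantumFields.BalabanUV.Beta.AxialDressingRooted (axEc)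
open Summit.QuantumFields.BalabanUV.Beta.SymShiftedSpread (bhKStepSh)
open Summit.QuantumFields.BalabanUV.Beta.DshAn1 (Dsh)
open Summit.QuantumFields.BalabanUV.Beta.FP.KernelPeriodisationFib (Idx perF perF_apply perZ perZ_apply)
open Summit.QuantumFields.BalabanUV.Beta.FP.KernelPeriodisationFibLoc (dper dper_apply)
open Summit.QuantumFields.BalabanUV.Beta.FP.TorusGaugeCovariancePairing (wrapPt wrapPt_coe)
open Summit.QuantumFields.BalabanUV.Beta.FP.TorusCombRows (Res combRowsT)
open Summit.QuantumFields.BalabanUV.Beta.SymmetrisedStepJets (SymTables)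
open Summit.QuantumFields.BalabanUV.Beta.SymSecondOrderTablesAn1 (symTablesAn1S2)
open Summit.QuantumFields.BalabanUV.Beta.CombChartStepJets (GcombSh JsB12CombSh0)
open Summit.QuantumFields.BalabanUV.Beta.D1BFx.LiteralStencilSockets (JsB12CombSh0_S_an1_inl_inr)
open Summit.QuantumFields.BalabanUV.Beta.FP.CoarseJetOrderOneGradedComb (torus_hId₁_iff_graded_comb)
open Summit.QuantumFields.BalabanUV.Beta.CombHId1Record (smul_graded_word_eq_table_succ_sub_fresh_an1)

variable {d : ℕ}

/-! ## §1 Periodisation preserves a fibre-wise pointwise symmetry -/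

section Symm

variable (M : Fin (d + 1) → ℕ)

/-- [folklore] **FIBRE-LOCALISED SYMMETRY OF `perZ ∘ dper`**: if `V x z a b = V z x b a` for ALL sites at the FIXED fibre pair `(a, b)`, then
`perZ M (dper M V) x z a b = perZ M (dper M V) z x b a` (re-indexing of the two period sums; the proof of `PeriodisedBorderTables.perZ_dper_symm` verbatim). -/
theorem perZ_dper_symm_fibre {V : MKer (d + 1) (Fib d)} {a b : Fib d} (hV : ∀ x z : Site (d + 1), V x z a b = V z x b a)
    (x z : Site (d + 1)) : perZ M (dper M V) x z a b = perZ M (dper M V) z x b a := by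
  simp only [perZ_apply, dper_apply, translate_translate]
  rw [← (Equiv.neg (Site (d + 1))).tsum_eq fun m' => ∑' m, V (translate M z m) (translate M x (m' + m)) b a]
  refine tsum_congr fun m' => ?_
  rw [← (Equiv.addRight (-m')).tsum_eq fun m => V (translate M x m) (translate M z (m' + m)) a b]
  refine tsum_congr fun m => ?_
  simp only [Equiv.neg_apply, Equiv.coe_addRight, hV (translate M x _)]
  congr 2 <;> abel_nf

/-- [folklore] the matrix form: a fibre-wise `fm`-symmetric insertion has `perF M (dper M V) (s, inr ρ) (t, inl α) = perF M (dper M V) (t, inl α) (s, inr ρ)`. -/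
theorem perF_dper_inr_inl_eq [∀ μ, NeZero (M μ)] {V : MKer (d + 1) (Fib d)}
    (hV : ∀ (x z : Site (d + 1)) (c : Fin (d + 1)) (ρ : Fin (d + 1)), V x z (Sum.inl c) (Sum.inr ρ) = V z x (Sum.inr ρ) (Sum.inl c))
    (s t : ↥(pbox M)) (ρ α : Fin (d + 1)) :
    perF M (dper M V) (s, Sum.inr ρ) (t, Sum.inl α) = perF M (dper M V) (t, Sum.inl α) (s, Sum.inr ρ) := by
  rw [perF_apply, perF_apply]
  exact (perZ_dper_symm_fibre M (fun x z => hV x z α ρ) (t : Site (d + 1)) (s : Site (d + 1))).symm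

end Symm

/-! ## §2 At an1's record: the `ff ∕ fμ` block is the transpose of the `fμ ∕ ff` block -/

section Parity

variable (M : Fin 4 → ℕ) [∀ μ, NeZero (M μ)] {Lc : ℕ} [NeZero Lc]

/-- [folklore] **`Q′ = Q₁₁ᵀ` AT THE RECORD.**  For the RAW level-`j` tables `S_j` of `JsB12CombSh0 hLc N (symTablesAn1S2 3 Lc cΛ) cΛ cB` (fibre-wise `fm`-symmetric:
d1-formalise-leaf-01's `JsB12CombSh0_S_an1_inl_inr`) and an `inr`-valued coarse presentation `fμ`, the `ff ∕ fμ` block of `Σ_b h b • perF M (dper M (S_j b))` is the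
transpose of its `fμ ∕ ff` block. -/
theorem Qprime_eq_transpose_an1 (hLc : Odd Lc) (N : ℕ) (cΛ cB : ℝ) (j : ℕ) {M' : Fin 4 → ℕ} {μ : Type*} [Fintype μ] (ybar : μ → ↥(pbox M'))
    (mμ : μ → Fin 4) {fμ : μ → Idx M (Fib 3)} (hf : fμ = fun a => (wrapPt M ((Lc : ℤ) • (ybar a : Site 4)), Sum.inr (mμ a))) (h : ↥(pbox M) × Fin 4 → ℝ) :
    (∑ b : ↥(pbox M) × Fin 4, h b • (perF M (dper M ((JsB12CombSh0 hLc N (symTablesAn1S2 3 Lc cΛ) cΛ cB j).S b.2 (b.1 : Site 4)))).submatrix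
        (fun b : ↥(pbox M) × Fin 4 => ((b.1, Sum.inl b.2) : Idx M (Fib 3))) fμ)
      = (∑ b : ↥(pbox M) × Fin 4, h b • (perF M (dper M ((JsB12CombSh0 hLc N (symTablesAn1S2 3 Lc cΛ) cΛ cB j).S b.2 (b.1 : Site 4)))).submatrix fμ
        (fun b : ↥(pbox M) × Fin 4 => ((b.1, Sum.inl b.2) : Idx M (Fib 3))))ᵀ := by
  subst hf
  ext p a
  simp only [Matrix.transpose_apply, Matrix.submatrix_apply, Matrix.sum_apply, Matrix.smul_apply, smul_eq_mul]
  refine Finset.sum_congr rfl fun b _ => ?_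
  rw [perF_dper_inr_inl_eq M (fun x z c ρ => JsB12CombSh0_S_an1_inl_inr hLc N cΛ cB j b.2 (b.1 : Site 4) x z c ρ)]

/-- [folklore] **`Q′ = Q₁₁ᵀ` FOR ANY `fm`-SYMMETRIC FAMILY** (generic `d`, any box): with `fμ` `inr`-valued as above and
`hSfm : S κ u x z (inl c) (inr ρ) = S κ u z x (inr ρ) (inl c)`, the `ff ∕ fμ` block of `Σ_b h b • perF M (dper M (S b))` is the transpose of its `fμ ∕ ff` block. -/
theorem Qprime_eq_transpose {d : ℕ} (M : Fin (d + 1) → ℕ) [∀ μ, NeZero (M μ)] {N : ℕ} {S : Fin (d + 1) → Site (d + 1) → MKer (d + 1) (Fib d)}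
    (hSfm : ∀ (κ : Fin (d + 1)) (u x z : Site (d + 1)) (c ρ : Fin (d + 1)), S κ u x z (Sum.inl c) (Sum.inr ρ) = S κ u z x (Sum.inr ρ) (Sum.inl c))
    {M' : Fin (d + 1) → ℕ} {μ : Type*} [Fintype μ] (ybar : μ → ↥(pbox M')) (mμ : μ → Fin (d + 1)) {fμ : μ → Idx M (Fib d)}
    (hf : fμ = fun a => (wrapPt M ((N : ℤ) • (ybar a : Site (d + 1))), Sum.inr (mμ a))) (h : ↥(pbox M) × Fin (d + 1) → ℝ) :
    (∑ b : ↥(pbox M) × Fin (d + 1), h b • (perF M (dper M (S b.2 (b.1 : Site (d + 1))))).submatrix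
        (fun b : ↥(pbox M) × Fin (d + 1) => ((b.1, Sum.inl b.2) : Idx M (Fib d))) fμ)
      = (∑ b : ↥(pbox M) × Fin (d + 1), h b • (perF M (dper M (S b.2 (b.1 : Site (d + 1))))).submatrix fμ
        (fun b : ↥(pbox M) × Fin (d + 1) => ((b.1, Sum.inl b.2) : Idx M (Fib d))))ᵀ := by
  subst hf
  ext p a
  simp only [Matrix.transpose_apply, Matrix.submatrix_apply, Matrix.sum_apply, Matrix.smul_apply, smul_eq_mul]
  refine Finset.sum_congr rfl fun b _ => ?_
  rw [perF_dper_inr_inl_eq M (fun x z c ρ => hSfm b.2 (b.1 : Site (d + 1)) x z c ρ)]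

end Parity

/-! ## §3 The door's `hId₁` row for any `mm`-free, `fm`-symmetric record (generic `d`) -/

section DoorGeneric

open Summit.QuantumFields.BalabanUV.Beta.CombChartStepJets (ScombOf)
open Summit.QuantumFields.BalabanUV.Beta.CombHId1Record (smul_graded_word_eq_table_succ_sub_fresh)

variable (M : Fin (d + 1) → ℕ) [∀ μ, NeZero (M μ)] {Lc : ℕ} [NeZero Lc] (tabs : SymTables d Lc) (cE cVH cΛ : ℝ)

set_option synthInstance.maxSize 1024 in
/-- [folklore] **THE (STEP) DOOR's `hId₁` ROW AT THE RAW comb TABLES OF ANY RECORD** (generic `d`; `S_j := ScombOf tabs cE cVH cΛ j` `mm`-free (`hSmm`) and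
fibre-wise `fm`-symmetric (`hSfm`); chain currency `cE·wE d Lc (j+1) ≠ 0`): under leaf-05's presentation of record and the record bindings of `H₁ Q₁₁ h`,
`((L·H₁ − S·B)·I + L·Bᵀ·S).toBlocks₁₁ = (cE·wE (j+1))⁻¹ • (T_{j+1}(h̄) − (cVH·wVH (j+1)) • T^V(h̄) − (cΛ·wΛ (j+1)) • T^Λ_{j+1}(h̄))` — the form in which the
COMPOSITE-CONTOUR literal `JcOfTabs tabsComp` (RULING R-D1-g42-4) will consume it. -/
theorem door_hId1_at_record {M' : Fin (d + 1) → ℕ} [∀ μ, NeZero (M' μ)] (hM : ∀ i, M i = Lc * M' i) (j : ℕ)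
    (hw : cE * wE d Lc (j + 1) ≠ 0)
    (hSmm : ∀ (κ : Fin (d + 1)) (u x z : Site (d + 1)) (m m' : Fin (d + 1)), ScombOf tabs cE cVH cΛ j κ u x z (Sum.inr m) (Sum.inr m') = 0)
    (hSfm : ∀ (κ : Fin (d + 1)) (u x z : Site (d + 1)) (c ρ : Fin (d + 1)),
      ScombOf tabs cE cVH cΛ j κ u x z (Sum.inl c) (Sum.inr ρ) = ScombOf tabs cE cVH cΛ j κ u z x (Sum.inr ρ) (Sum.inl c))
    {μ : Type*} [Fintype μ] [DecidableEq μ] (ybar : μ → ↥(pbox M')) (mμ : μ → Fin (d + 1))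
    {fμ : μ → Idx M (Fib d)} (hf : fμ = fun a => (wrapPt M ((Lc : ℤ) • (ybar a : Site (d + 1))), Sum.inr (mμ a)))
    (hfμ : Function.Injective fμ)
    (hcoarse : ∀ (s : ↥(pbox M)) (m : Fin (d + 1)), ((s, Sum.inr m) : Idx M (Fib d)) ∈ Set.range fμ ↔ Torus.proj Lc (s : Site (d + 1)) = 0)
    {H₀ : Matrix (↥(pbox M) × Fin (d + 1)) (↥(pbox M) × Fin (d + 1)) ℝ} {Q₁₀ : Matrix μ (↥(pbox M) × Fin (d + 1)) ℝ}
    {τ₁ : Matrix (Res (ctr (d + 1) Lc) Lc M) (↥(pbox M) × Fin (d + 1)) ℝ}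
    (hH₀ : H₀ = (perF M (bhKStepSh d Lc (Dsh Lc) j)).submatrix
        (fun b : ↥(pbox M) × Fin (d + 1) => ((b.1, Sum.inl b.2) : Idx M (Fib d))) (fun b : ↥(pbox M) × Fin (d + 1) => ((b.1, Sum.inl b.2) : Idx M (Fib d))))
    (hQ₁₀ : Q₁₀ = (perF M (bhKStepSh d Lc (Dsh Lc) j)).submatrix fμ (fun b : ↥(pbox M) × Fin (d + 1) => ((b.1, Sum.inl b.2) : Idx M (Fib d))))
    (hτ₁ : τ₁ = (combRowsT (ctr (d + 1) Lc) Lc M).submatrix id (fun b : ↥(pbox M) × Fin (d + 1) => ((b.1, Sum.inl b.2) : Idx M (Fib d))))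
    {I : Matrix (↥(pbox M) × Fin (d + 1)) (μ ⊕ Res (ctr (d + 1) Lc) Lc M) ℝ} {L : Matrix (μ ⊕ Res (ctr (d + 1) Lc) Lc M) (↥(pbox M) × Fin (d + 1)) ℝ}
    {S : Matrix (μ ⊕ Res (ctr (d + 1) Lc) Lc M) (μ ⊕ Res (ctr (d + 1) Lc) Lc M) ℝ} {B : Matrix (μ ⊕ Res (ctr (d + 1) Lc) Lc M) (↥(pbox M) × Fin (d + 1)) ℝ}
    (hI : minOp H₀ (Matrix.fromRows Q₁₀ τ₁) = I) (hL : minOpL H₀ (Matrix.fromRows Q₁₀ τ₁) = L) (hS : effForm H₀ (Matrix.fromRows Q₁₀ τ₁) = S)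
    (hbar : μ → ℝ) {h : ↥(pbox M) × Fin (d + 1) → ℝ}
    (hh : ∀ b, h b = ∑ a, (axEc (ctr (d + 1) Lc) Lc (b.1 : Site (d + 1)) (b.1 : Site (d + 1)) (Sum.inl b.2) (Sum.inl b.2)
        * perF M (GcombSh (d := d) Lc j) (b.1, Sum.inl b.2) (fμ a)) * hbar a)
    {H₁ : Matrix (↥(pbox M) × Fin (d + 1)) (↥(pbox M) × Fin (d + 1)) ℝ} {Q₁₁ : Matrix μ (↥(pbox M) × Fin (d + 1)) ℝ}
    (hH₁ : H₁ = ∑ b : ↥(pbox M) × Fin (d + 1), h b • (perF M (dper M (ScombOf tabs cE cVH cΛ j b.2 (b.1 : Site (d + 1))))).submatrix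
      (fun b : ↥(pbox M) × Fin (d + 1) => ((b.1, Sum.inl b.2) : Idx M (Fib d))) (fun b : ↥(pbox M) × Fin (d + 1) => ((b.1, Sum.inl b.2) : Idx M (Fib d))))
    (hQ₁₁ : Q₁₁ = ∑ b : ↥(pbox M) × Fin (d + 1), h b • (perF M (dper M (ScombOf tabs cE cVH cΛ j b.2 (b.1 : Site (d + 1))))).submatrix fμ
      (fun b : ↥(pbox M) × Fin (d + 1) => ((b.1, Sum.inl b.2) : Idx M (Fib d))))
    (hB : Matrix.fromRows Q₁₁ (0 : Matrix (Res (ctr (d + 1) Lc) Lc M) (↥(pbox M) × Fin (d + 1)) ℝ) = B) :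
    ((L * H₁ - S * B) * I + L * Bᵀ * S).toBlocks₁₁
      = (cE * wE d Lc (j + 1))⁻¹ •
        ((∑ a, hbar a • (perF M' (dper M' (ScombOf tabs cE cVH cΛ (j + 1) (mμ a) (ybar a : Site (d + 1))))).submatrix
              (fun a : μ => ((ybar a, Sum.inl (mμ a)) : Idx M' (Fib d))) (fun a : μ => ((ybar a, Sum.inl (mμ a)) : Idx M' (Fib d))))
          - (cVH * wVH d Lc (j + 1)) • (∑ a, hbar a • (perF M' (dper M' (tabs.V (mμ a) (ybar a : Site (d + 1))))).submatrix
              (fun a : μ => ((ybar a, Sum.inl (mμ a)) : Idx M' (Fib d))) (fun a : μ => ((ybar a, Sum.inl (mμ a)) : Idx M' (Fib d))))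
          - (cΛ * wΛ d Lc (j + 1)) • (∑ a, hbar a •
              (perF M' (dper M' (SLam Lc (lamCoeffK (KInvStep (d := d) Lc (j + 1)) (E2 d Lc (j + 1)) Lc) tabs.H (mμ a)
                (ybar a : Site (d + 1))))).submatrix
              (fun a : μ => ((ybar a, Sum.inl (mμ a)) : Idx M' (Fib d))) (fun a : μ => ((ybar a, Sum.inl (mμ a)) : Idx M' (Fib d))))) := by
  have hLM : ∀ i, Lc ∣ M i := fun i => ⟨M' i, hM i⟩
  have hμ : ∀ a : μ, ∃ m : Fin (d + 1), (fμ a).2 = Sum.inr m := fun a => ⟨mμ a, by rw [hf]⟩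
  rw [torus_hId₁_iff_graded_comb M hLM j fμ hfμ hμ hcoarse hH₀ hQ₁₀ hτ₁ hI hL hS H₁ Q₁₁ hB]
  have hQ' := Qprime_eq_transpose M (N := Lc) hSfm ybar mμ hf h
  rw [← hQ₁₁] at hQ'
  have key := smul_graded_word_eq_table_succ_sub_fresh M tabs cE cVH cΛ hM j hSmm ybar mμ hf hfμ hcoarse hbar rfl rfl rfl hh hH₁ hQ₁₁ hQ'.symm
  exact (eq_inv_smul_iff₀ hw).2 key

end DoorGeneric

/-! ## §4 The door's `hId₁` row at an1's record (`d + 1 = 4`) -/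

section Door

variable (M : Fin 4 → ℕ) [∀ μ, NeZero (M μ)] {Lc : ℕ} [NeZero Lc]

omit [∀ μ, NeZero (M μ)] in
/-- [folklore] the currency of the chain part is invertible: `Lc⁴·wE 3 Lc (j+1) ≠ 0`. -/
theorem formChainWeight_ne_zero (j : ℕ) : (Lc : ℝ) ^ 4 * wE 3 Lc (j + 1) ≠ 0 := by
  have hL : (0 : ℝ) < Lc := Nat.cast_pos.2 (Nat.pos_of_ne_zero (NeZero.ne Lc))
  unfold wE
  positivity

set_option synthInstance.maxSize 1024 in
/-- [folklore] **THE (STEP) DOOR's `hId₁` ROW AT THE (III′) LITERAL OF RECORD.**  On any box `M = Lc·M′` (root `ρ_c = ctr 4 Lc`, level `j`), at the door's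
presentation of record (`hH₀ hQ₁₀ hτ₁`; coarse multipliers by the coarse-site presentation `fμ a = (wrapPt M (Lc•ȳ a), inr (m a))` with `hfμ hcoarse`; namings
`hI hL hS hB`), with the first jets BOUND to the RAW level-`j` tables `S_j` of `JsB12CombSh0 hLc N (symTablesAn1S2 3 Lc cΛ) cΛ cB` along `h = Θ·h̄`
(`hH₁ hQ₁₁ hh`): the coarse first jet of the torus call IS
`(Lc⁴·wE 3 Lc (j+1))⁻¹ • (T_{j+1}(h̄) − (−Lc⁸∕2·wVH 3 Lc (j+1)) • T^V(h̄) − (cΛ·wΛ 3 Lc (j+1)) • T^Λ_{j+1}(h̄))`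
— `hId₁` with `c := (Lc⁴·wE 3 Lc (j+1))⁻¹`, `H′₁ :=` the chain part of the level-`(j+1)` coarse first-order table along `h̄`. -/
theorem door_hId1_at_record_an1 (hLc : Odd Lc) (N : ℕ) (cΛ cB : ℝ) {M' : Fin 4 → ℕ} [∀ μ, NeZero (M' μ)] (hM : ∀ i, M i = Lc * M' i) (j : ℕ)
    {μ : Type*} [Fintype μ] [DecidableEq μ] (ybar : μ → ↥(pbox M')) (mμ : μ → Fin 4)
    {fμ : μ → Idx M (Fib 3)} (hf : fμ = fun a => (wrapPt M ((Lc : ℤ) • (ybar a : Site 4)), Sum.inr (mμ a)))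
    (hfμ : Function.Injective fμ)
    (hcoarse : ∀ (s : ↥(pbox M)) (m : Fin 4), ((s, Sum.inr m) : Idx M (Fib 3)) ∈ Set.range fμ ↔ Torus.proj Lc (s : Site 4) = 0)
    -- the door's presentation of record
    {H₀ : Matrix (↥(pbox M) × Fin 4) (↥(pbox M) × Fin 4) ℝ} {Q₁₀ : Matrix μ (↥(pbox M) × Fin 4) ℝ} {τ₁ : Matrix (Res (ctr 4 Lc) Lc M) (↥(pbox M) × Fin 4) ℝ}
    (hH₀ : H₀ = (perF M (bhKStepSh 3 Lc (Dsh Lc) j)).submatrix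
        (fun b : ↥(pbox M) × Fin 4 => ((b.1, Sum.inl b.2) : Idx M (Fib 3))) (fun b : ↥(pbox M) × Fin 4 => ((b.1, Sum.inl b.2) : Idx M (Fib 3))))
    (hQ₁₀ : Q₁₀ = (perF M (bhKStepSh 3 Lc (Dsh Lc) j)).submatrix fμ (fun b : ↥(pbox M) × Fin 4 => ((b.1, Sum.inl b.2) : Idx M (Fib 3))))
    (hτ₁ : τ₁ = (combRowsT (ctr 4 Lc) Lc M).submatrix id (fun b : ↥(pbox M) × Fin 4 => ((b.1, Sum.inl b.2) : Idx M (Fib 3))))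
    {I : Matrix (↥(pbox M) × Fin 4) (μ ⊕ Res (ctr 4 Lc) Lc M) ℝ} {L : Matrix (μ ⊕ Res (ctr 4 Lc) Lc M) (↥(pbox M) × Fin 4) ℝ}
    {S : Matrix (μ ⊕ Res (ctr 4 Lc) Lc M) (μ ⊕ Res (ctr 4 Lc) Lc M) ℝ} {B : Matrix (μ ⊕ Res (ctr 4 Lc) Lc M) (↥(pbox M) × Fin 4) ℝ}
    (hI : minOp H₀ (Matrix.fromRows Q₁₀ τ₁) = I) (hL : minOpL H₀ (Matrix.fromRows Q₁₀ τ₁) = L) (hS : effForm H₀ (Matrix.fromRows Q₁₀ τ₁) = S)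
    -- the direction and the first jets bound to the record
    (hbar : μ → ℝ) {h : ↥(pbox M) × Fin 4 → ℝ}
    (hh : ∀ b, h b = ∑ a, (axEc (ctr 4 Lc) Lc (b.1 : Site 4) (b.1 : Site 4) (Sum.inl b.2) (Sum.inl b.2)
        * perF M (GcombSh (d := 3) Lc j) (b.1, Sum.inl b.2) (fμ a)) * hbar a)
    {H₁ : Matrix (↥(pbox M) × Fin 4) (↥(pbox M) × Fin 4) ℝ} {Q₁₁ : Matrix μ (↥(pbox M) × Fin 4) ℝ}
    (hH₁ : H₁ = ∑ b : ↥(pbox M) × Fin 4, h b •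
      (perF M (dper M ((JsB12CombSh0 hLc N (symTablesAn1S2 3 Lc cΛ) cΛ cB j).S b.2 (b.1 : Site 4)))).submatrix
      (fun b : ↥(pbox M) × Fin 4 => ((b.1, Sum.inl b.2) : Idx M (Fib 3))) (fun b : ↥(pbox M) × Fin 4 => ((b.1, Sum.inl b.2) : Idx M (Fib 3))))
    (hQ₁₁ : Q₁₁ = ∑ b : ↥(pbox M) × Fin 4, h b •
      (perF M (dper M ((JsB12CombSh0 hLc N (symTablesAn1S2 3 Lc cΛ) cΛ cB j).S b.2 (b.1 : Site 4)))).submatrix fμ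
      (fun b : ↥(pbox M) × Fin 4 => ((b.1, Sum.inl b.2) : Idx M (Fib 3))))
    (hB : Matrix.fromRows Q₁₁ (0 : Matrix (Res (ctr 4 Lc) Lc M) (↥(pbox M) × Fin 4) ℝ) = B) :
    ((L * H₁ - S * B) * I + L * Bᵀ * S).toBlocks₁₁
      = ((Lc : ℝ) ^ 4 * wE 3 Lc (j + 1))⁻¹ •
        ((∑ a, hbar a • (perF M' (dper M' ((JsB12CombSh0 hLc N (symTablesAn1S2 3 Lc cΛ) cΛ cB (j + 1)).S (mμ a) (ybar a : Site 4)))).submatrix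
              (fun a : μ => ((ybar a, Sum.inl (mμ a)) : Idx M' (Fib 3))) (fun a : μ => ((ybar a, Sum.inl (mμ a)) : Idx M' (Fib 3))))
          - (-((Lc : ℝ) ^ 8 / 2) * wVH 3 Lc (j + 1)) • (∑ a, hbar a •
              (perF M' (dper M' ((symTablesAn1S2 3 Lc cΛ).V (mμ a) (ybar a : Site 4)))).submatrix
              (fun a : μ => ((ybar a, Sum.inl (mμ a)) : Idx M' (Fib 3))) (fun a : μ => ((ybar a, Sum.inl (mμ a)) : Idx M' (Fib 3))))
          - (cΛ * wΛ 3 Lc (j + 1)) • (∑ a, hbar a •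
              (perF M' (dper M' (SLam Lc (lamCoeffK (KInvStep (d := 3) Lc (j + 1)) (E2 3 Lc (j + 1)) Lc) (symTablesAn1S2 3 Lc cΛ).H (mμ a)
                (ybar a : Site 4)))).submatrix
              (fun a : μ => ((ybar a, Sum.inl (mμ a)) : Idx M' (Fib 3))) (fun a : μ => ((ybar a, Sum.inl (mμ a)) : Idx M' (Fib 3))))) := by
  have hLM : ∀ i, Lc ∣ M i := fun i => ⟨M' i, hM i⟩
  have hμ : ∀ a : μ, ∃ m : Fin 4, (fμ a).2 = Sum.inr m := fun a => ⟨mμ a, by rw [hf]⟩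
  rw [torus_hId₁_iff_graded_comb M hLM j fμ hfμ hμ hcoarse hH₀ hQ₁₀ hτ₁ hI hL hS H₁ Q₁₁ hB]
  have hQ' := Qprime_eq_transpose_an1 M hLc N cΛ cB j ybar mμ hf h
  rw [← hQ₁₁] at hQ'
  have key := smul_graded_word_eq_table_succ_sub_fresh_an1 M hLc N cΛ cB hM j ybar mμ hf hfμ hcoarse hbar rfl rfl rfl hh hH₁ hQ₁₁ hQ'.symm
  exact (eq_inv_smul_iff₀ (formChainWeight_ne_zero (Lc := Lc) j)).2 key

/-- [folklore] **THE BORDER COMPANION VANISHES ON THE COARSE `ff` BLOCK AT an1's RECORD**: the border table `V = symVhSAt ρ_c` has no field–field block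
(`SymAveragingHessianCounts.symVhSAt_inl_inl`, by `rfl`), hence so has its periodisation — `T^V(h̄) = 0`. -/
theorem TV_an1_ff_eq_zero (cΛ : ℝ) {M' : Fin 4 → ℕ} [∀ μ, NeZero (M' μ)] {μ : Type*} [Fintype μ] (ybar : μ → ↥(pbox M')) (mμ : μ → Fin 4)
    (hbar : μ → ℝ) :
    (∑ a, hbar a • (perF M' (dper M' ((symTablesAn1S2 3 Lc cΛ).V (mμ a) (ybar a : Site 4)))).submatrix
        (fun a : μ => ((ybar a, Sum.inl (mμ a)) : Idx M' (Fib 3))) (fun a : μ => ((ybar a, Sum.inl (mμ a)) : Idx M' (Fib 3)))) = 0 := by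
  refine Finset.sum_eq_zero fun a _ => ?_
  ext i k
  simp only [Matrix.smul_apply, Matrix.submatrix_apply, Matrix.zero_apply, perF_apply, perZ_apply, dper_apply,
    SymSecondOrderTablesAn1.symTablesAn1S2_V, SymAveragingHessianCounts.symVhSAt_inl_inl, tsum_zero, smul_eq_mul, mul_zero]

set_option synthInstance.maxSize 1024 in
/-- [folklore] **THE DOOR's `hId₁` ROW AT THE RECORD, SHARPENED — ONLY THE Λ-COMPANION SURVIVES**: with the letters of `door_hId1_at_record_an1`,
`((L·H₁ − S·B)·I + L·Bᵀ·S).toBlocks₁₁ = (Lc⁴·wE 3 Lc (j+1))⁻¹ • (T_{j+1}(h̄) − (cΛ·wΛ 3 Lc (j+1)) • T^Λ_{j+1}(h̄))` (`T^V = 0`, `TV_an1_ff_eq_zero`). -/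
theorem door_hId1_at_record_an1' (hLc : Odd Lc) (N : ℕ) (cΛ cB : ℝ) {M' : Fin 4 → ℕ} [∀ μ, NeZero (M' μ)] (hM : ∀ i, M i = Lc * M' i) (j : ℕ)
    {μ : Type*} [Fintype μ] [DecidableEq μ] (ybar : μ → ↥(pbox M')) (mμ : μ → Fin 4)
    {fμ : μ → Idx M (Fib 3)} (hf : fμ = fun a => (wrapPt M ((Lc : ℤ) • (ybar a : Site 4)), Sum.inr (mμ a)))
    (hfμ : Function.Injective fμ)
    (hcoarse : ∀ (s : ↥(pbox M)) (m : Fin 4), ((s, Sum.inr m) : Idx M (Fib 3)) ∈ Set.range fμ ↔ Torus.proj Lc (s : Site 4) = 0)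
    {H₀ : Matrix (↥(pbox M) × Fin 4) (↥(pbox M) × Fin 4) ℝ} {Q₁₀ : Matrix μ (↥(pbox M) × Fin 4) ℝ} {τ₁ : Matrix (Res (ctr 4 Lc) Lc M) (↥(pbox M) × Fin 4) ℝ}
    (hH₀ : H₀ = (perF M (bhKStepSh 3 Lc (Dsh Lc) j)).submatrix
        (fun b : ↥(pbox M) × Fin 4 => ((b.1, Sum.inl b.2) : Idx M (Fib 3))) (fun b : ↥(pbox M) × Fin 4 => ((b.1, Sum.inl b.2) : Idx M (Fib 3))))
    (hQ₁₀ : Q₁₀ = (perF M (bhKStepSh 3 Lc (Dsh Lc) j)).submatrix fμ (fun b : ↥(pbox M) × Fin 4 => ((b.1, Sum.inl b.2) : Idx M (Fib 3))))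
    (hτ₁ : τ₁ = (combRowsT (ctr 4 Lc) Lc M).submatrix id (fun b : ↥(pbox M) × Fin 4 => ((b.1, Sum.inl b.2) : Idx M (Fib 3))))
    {I : Matrix (↥(pbox M) × Fin 4) (μ ⊕ Res (ctr 4 Lc) Lc M) ℝ} {L : Matrix (μ ⊕ Res (ctr 4 Lc) Lc M) (↥(pbox M) × Fin 4) ℝ}
    {S : Matrix (μ ⊕ Res (ctr 4 Lc) Lc M) (μ ⊕ Res (ctr 4 Lc) Lc M) ℝ} {B : Matrix (μ ⊕ Res (ctr 4 Lc) Lc M) (↥(pbox M) × Fin 4) ℝ}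
    (hI : minOp H₀ (Matrix.fromRows Q₁₀ τ₁) = I) (hL : minOpL H₀ (Matrix.fromRows Q₁₀ τ₁) = L) (hS : effForm H₀ (Matrix.fromRows Q₁₀ τ₁) = S)
    (hbar : μ → ℝ) {h : ↥(pbox M) × Fin 4 → ℝ}
    (hh : ∀ b, h b = ∑ a, (axEc (ctr 4 Lc) Lc (b.1 : Site 4) (b.1 : Site 4) (Sum.inl b.2) (Sum.inl b.2)
        * perF M (GcombSh (d := 3) Lc j) (b.1, Sum.inl b.2) (fμ a)) * hbar a)
    {H₁ : Matrix (↥(pbox M) × Fin 4) (↥(pbox M) × Fin 4) ℝ} {Q₁₁ : Matrix μ (↥(pbox M) × Fin 4) ℝ}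
    (hH₁ : H₁ = ∑ b : ↥(pbox M) × Fin 4, h b •
      (perF M (dper M ((JsB12CombSh0 hLc N (symTablesAn1S2 3 Lc cΛ) cΛ cB j).S b.2 (b.1 : Site 4)))).submatrix
      (fun b : ↥(pbox M) × Fin 4 => ((b.1, Sum.inl b.2) : Idx M (Fib 3))) (fun b : ↥(pbox M) × Fin 4 => ((b.1, Sum.inl b.2) : Idx M (Fib 3))))
    (hQ₁₁ : Q₁₁ = ∑ b : ↥(pbox M) × Fin 4, h b •
      (perF M (dper M ((JsB12CombSh0 hLc N (symTablesAn1S2 3 Lc cΛ) cΛ cB j).S b.2 (b.1 : Site 4)))).submatrix fμ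
      (fun b : ↥(pbox M) × Fin 4 => ((b.1, Sum.inl b.2) : Idx M (Fib 3))))
    (hB : Matrix.fromRows Q₁₁ (0 : Matrix (Res (ctr 4 Lc) Lc M) (↥(pbox M) × Fin 4) ℝ) = B) :
    ((L * H₁ - S * B) * I + L * Bᵀ * S).toBlocks₁₁
      = ((Lc : ℝ) ^ 4 * wE 3 Lc (j + 1))⁻¹ •
        ((∑ a, hbar a • (perF M' (dper M' ((JsB12CombSh0 hLc N (symTablesAn1S2 3 Lc cΛ) cΛ cB (j + 1)).S (mμ a) (ybar a : Site 4)))).submatrix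
              (fun a : μ => ((ybar a, Sum.inl (mμ a)) : Idx M' (Fib 3))) (fun a : μ => ((ybar a, Sum.inl (mμ a)) : Idx M' (Fib 3))))
          - (cΛ * wΛ 3 Lc (j + 1)) • (∑ a, hbar a •
              (perF M' (dper M' (SLam Lc (lamCoeffK (KInvStep (d := 3) Lc (j + 1)) (E2 3 Lc (j + 1)) Lc) (symTablesAn1S2 3 Lc cΛ).H (mμ a)
                (ybar a : Site 4)))).submatrix
              (fun a : μ => ((ybar a, Sum.inl (mμ a)) : Idx M' (Fib 3))) (fun a : μ => ((ybar a, Sum.inl (mμ a)) : Idx M' (Fib 3))))) := by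
  rw [door_hId1_at_record_an1 M hLc N cΛ cB hM j ybar mμ hf hfμ hcoarse hH₀ hQ₁₀ hτ₁ hI hL hS hbar hh hH₁ hQ₁₁ hB, TV_an1_ff_eq_zero, smul_zero,
    sub_zero]

end Door

end Summit.QuantumFields.BalabanUV.Beta.CombHId1Door

end
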